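import Literature.Topology.FourManifolds.TrisectionsProductStructure
import Literature.Topology.FourManifolds.RegularSublevelSet
import Mathlib.Geometry.Manifold.Immersion
import Mathlib.Geometry.Manifold.Instances.Real
import HarnessLib

/-!
# Re-structuring a sector of a Gay–Kirby trisection from ambient data: the corner-slice atlas

Topic `Literature/Topology/FourManifolds`; infrastructure for the fact seat
`provefact-Literature.Topology.FourManifolds.exists-14560f9fc8` (named fact (c′)
`Literature.Topology.FourManifolds.exists_stabilized_gkTrisection`), continuing
`TrisectionsProductStructure.lean`.  Everything in this file is **proved**; no definitions,
no named facts.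

A sector `S i` of a trisection with corners (`Literature.Topology.FourManifolds.IsGKTrisection`)
comes with *some* smooth `4`-manifold with boundary `Wᵢ` embedded onto it (clause (ii)); the
straightening of the angle along the central surface `F` hidden in `Wᵢ` is not unique, and the
stabilisation construction (Gay–Kirby, Def. 8) needs sector structures which are *products*
near `F`.  This file re-structures the sector from ambient data: with the global normal
coordinates `u, v` and the retraction `ρ` of `TrisectionsProductStructure.lean` it assembles a
**corner-slice atlas** `Literature.Topology.FourManifolds.CornerSliceAtlas (S i) F u v ρ`
(`TrisectionsSectorAtlas.lean`):

* `exists_halfSliceChart_of_isImmersionAt` — the image of a `4`-manifold with boundary under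
  a topological embedding which is an immersion at `w` (Mathlib's `Manifold.IsImmersionAt`:
  in suitable charts the map is a linear injection `ℝ⁴ → ℝ⁴ × F`, hence a linear isomorphism
  onto `ℝ⁴`) is, near the image point, a half-space domain: a half-slice chart
  (`Literature.Topology.FourManifolds.HalfSliceChart`) with source in any given neighbourhood;
* **`IsGKTrisection.exists_cornerSliceAtlas`** — normal coordinates, the retraction, and a
  corner-slice atlas of `S i` relative to `(F, u, v, ρ)`; by
  `CornerSliceAtlas.sector_smooth_clause` the subset `S i` with the straightened structure is
  then a smooth `4`-manifold with boundary whose inclusion is a topological embedding, an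
  immersion off `F`, with corner charts and boundary points along `F`.

## References

* D. Gay, R. Kirby, *Trisecting 4-manifolds*, Geom. Topol. 20 (2016) 3097–3132, Def. 1 and
  Def. 8. [GayKirby2016]
* A. Douady, *Variétés à bord anguleux et voisinages tubulaires*, Séminaire H. Cartan 14
  (1961/62), exp. 1, §4. [Douady1961]
* J. Margalef-Roig, E. Outerelo Domínguez, *Differential Topology* (1992), Ch. II (immersions
  in charts; Mathlib's definition). [folklore]
-/

open scoped Manifold ContDiff Topology
open Set Function Filter

noncomputable section

namespace Literature.Topology.FourManifolds

universe u

section HalfSlice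

variable {X : Type u} [TopologicalSpace X] [ChartedSpace (EuclideanSpace ℝ (Fin 4)) X]
  {W : Type u} [TopologicalSpace W] [ChartedSpace (EuclideanHalfSpace 4) W]

/-- **The image of a `4`-manifold with boundary under a topological embedding which is an
immersion at `w` is, near `e w`, a half-space domain of `X`.**  Precisely: for any open
`V ∋ e w` there is a half-slice chart (`Literature.Topology.FourManifolds.HalfSliceChart`:
a local diffeomorphism `Θ` of `X` into `ℝ⁴` with `q ∈ e(W) ↔ 0 ≤ (Θ q)₀` on its source) at
`e w` with source inside `V` (in the charts of Mathlib's `Manifold.IsImmersionAt` the map reads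
as a linear injection `ℝ⁴ → ℝ⁴`, i.e. a linear isomorphism `L`; compose the chart of `X` with
`L⁻¹`). [folklore] -/
theorem exists_halfSliceChart_of_isImmersionAt {e : W → X} (he : Topology.IsEmbedding e)
    {Sset : Set X} (hS : range e = Sset)
    {w : W} (himm : Manifold.IsImmersionAt (𝓡∂ 4) (𝓡 4) ∞ e w) {V : Set X} (hV : IsOpen V)
    (hwV : e w ∈ V) :
    ∃ D : HalfSliceChart (𝓡 4) Sset, e w ∈ D.Θ.source ∧ D.Θ.source ⊆ V := by
  subst hS
  obtain ⟨F, _, _, h⟩ := himm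
  set φ := h.domChart with hφ
  set ψ := h.codChart with hψ
  have hwφ : w ∈ φ.source := h.mem_domChart_source
  have hψmem : ψ ∈ IsManifold.maximalAtlas (𝓡 4) ∞ X := h.codChart_mem_maximalAtlas
  have hsrc : φ.source ⊆ e ⁻¹' ψ.source := h.source_subset_preimage_source
  have hwritten := h.writtenInCharts
  rw [← hφ, ← hψ] at hwritten
  -- the linear injection `L z = equiv (z, 0)` is a linear isomorphism of `ℝ⁴`
  set L : EuclideanSpace ℝ (Fin 4) →L[ℝ] EuclideanSpace ℝ (Fin 4) :=
    (h.equiv : (EuclideanSpace ℝ (Fin 4) × F) →L[ℝ] EuclideanSpace ℝ (Fin 4)).comp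
      (ContinuousLinearMap.inl ℝ (EuclideanSpace ℝ (Fin 4)) F) with hL
  have hLapply : ∀ z, L z = h.equiv (z, 0) := fun z => rfl
  have hLinj : Injective L := fun z z' hzz => by
    rw [hLapply, hLapply] at hzz
    exact (Prod.mk.inj (h.equiv.injective hzz)).1
  set Le : EuclideanSpace ℝ (Fin 4) ≃L[ℝ] EuclideanSpace ℝ (Fin 4) :=
    LinearEquiv.toContinuousLinearEquiv (LinearEquiv.ofInjectiveEndo L.toLinearMap hLinj) with hLe
  have hLe : ∀ z, Le z = L z := fun z => rfl
  -- the chart `Θ = Le⁻¹ ∘ ψ`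
  set Θ₀ : OpenPartialHomeomorph X (EuclideanSpace ℝ (Fin 4)) :=
    ψ.trans Le.symm.toHomeomorph.toOpenPartialHomeomorph with hΘ₀
  have hΘ₀coe : ∀ q, Θ₀ q = Le.symm (ψ q) := fun q => rfl
  have hΘ₀symm : ∀ z, Θ₀.symm z = ψ.symm (Le z) := fun z => rfl
  have hΘ₀src : Θ₀.source = ψ.source := by
    rw [hΘ₀, OpenPartialHomeomorph.trans_source]; simp
  -- the written-in-charts identity, unfolded: `ψ (e (φ.symm (I.symm z))) = L z` on the target
  have hext_symm : ∀ z, (φ.extend (𝓡∂ 4)).symm z = φ.symm ((𝓡∂ 4).symm z) := fun z => by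
    rw [OpenPartialHomeomorph.extend_coe_symm]; rfl
  have hext_tgt : (φ.extend (𝓡∂ 4)).target = (𝓡∂ 4).symm ⁻¹' φ.target ∩ range (𝓡∂ 4) :=
    OpenPartialHomeomorph.extend_target _
  have hkey : ∀ z ∈ (φ.extend (𝓡∂ 4)).target, ψ (e (φ.symm ((𝓡∂ 4).symm z))) = L z := by
    intro z hz
    have := hwritten hz
    simp only [comp_apply, OpenPartialHomeomorph.extend_coe, modelWithCornersSelf_coe,
      id_eq] at this
    rw [hext_symm] at this
    rw [this, hLapply]
  -- the open set `V'` of `ℝ⁴` with `target = V' ∩ {0 ≤ z 0}`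
  set V' : Set (EuclideanSpace ℝ (Fin 4)) := (𝓡∂ 4).symm ⁻¹' φ.target with hV'
  have hV'o : IsOpen V' := φ.open_target.preimage (𝓡∂ 4).continuous_symm
  have htgt : (φ.extend (𝓡∂ 4)).target = V' ∩ {z | 0 ≤ z 0} := by
    rw [hext_tgt, hV', range_modelWithCornersEuclideanHalfSpace]
  -- the open set `N` of `X` with `e '' φ.source = range e ∩ N`
  obtain ⟨N, hNo, hNe⟩ := he.isInducing.isOpen_iff.1 φ.open_source
  -- the source
  set Src : Set X := Θ₀ ⁻¹' V' ∩ N ∩ V with hSrc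
  have hcontΘ₀ : ContinuousOn Θ₀ Θ₀.source := Θ₀.continuousOn
  have hSrco : IsOpen (Θ₀.source ∩ Src) := by
    rw [hSrc, ← inter_assoc, ← inter_assoc]
    exact ((hcontΘ₀.isOpen_inter_preimage Θ₀.open_source hV'o).inter hNo).inter hV
  set Θ := Θ₀.restrOpen (Θ₀.source ∩ Src) hSrco with hΘ
  have hΘsrc : Θ.source = Θ₀.source ∩ Src := by
    rw [hΘ, OpenPartialHomeomorph.restrOpen_source, ← inter_assoc, inter_self]
  have hΘcoe : ∀ q, Θ q = Le.symm (ψ q) := fun q => rfl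
  -- `Θ (e w') = φ.extend w'` for `w' ∈ φ.source`
  have hΘe : ∀ w' ∈ φ.source, Le.symm (ψ (e w')) = φ.extend (𝓡∂ 4) w' ∧
      φ.extend (𝓡∂ 4) w' ∈ (φ.extend (𝓡∂ 4)).target := by
    intro w' hw'
    have hz : φ.extend (𝓡∂ 4) w' ∈ (φ.extend (𝓡∂ 4)).target :=
      (φ.extend (𝓡∂ 4)).map_source (by rw [OpenPartialHomeomorph.extend_source]; exact hw')
    have h1 := hkey _ hz
    have h2 : φ.symm ((𝓡∂ 4).symm (φ.extend (𝓡∂ 4) w')) = w' := by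
      rw [← hext_symm]
      exact (φ.extend (𝓡∂ 4)).left_inv (by rw [OpenPartialHomeomorph.extend_source]; exact hw')
    rw [h2] at h1
    refine ⟨?_, hz⟩
    rw [h1, ← hLe, ContinuousLinearEquiv.symm_apply_apply]
  -- smoothness
  have hΘ₀s : ContMDiffOn (𝓡 4) 𝓘(ℝ, EuclideanSpace ℝ (Fin 4)) ∞ Θ₀ Θ₀.source := by
    rw [hΘ₀src]
    have h1 : ContMDiffOn (𝓡 4) (𝓡 4) ∞ ψ ψ.source := contMDiffOn_of_mem_maximalAtlas hψmem
    have h2 : ContMDiff 𝓘(ℝ, EuclideanSpace ℝ (Fin 4)) 𝓘(ℝ, EuclideanSpace ℝ (Fin 4)) ∞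
        (Le.symm : EuclideanSpace ℝ (Fin 4) → EuclideanSpace ℝ (Fin 4)) :=
      contMDiff_iff_contDiff.2 Le.symm.contDiff
    exact h2.comp_contMDiffOn h1
  have hΘ₀s' : ContMDiffOn 𝓘(ℝ, EuclideanSpace ℝ (Fin 4)) (𝓡 4) ∞ Θ₀.symm Θ₀.target := by
    have h1 : ContMDiffOn 𝓘(ℝ, EuclideanSpace ℝ (Fin 4)) (𝓡 4) ∞ ψ.symm ψ.target :=
      contMDiffOn_symm_of_mem_maximalAtlas hψmem
    have h2 : ContMDiff 𝓘(ℝ, EuclideanSpace ℝ (Fin 4)) 𝓘(ℝ, EuclideanSpace ℝ (Fin 4)) ∞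
        (Le : EuclideanSpace ℝ (Fin 4) → EuclideanSpace ℝ (Fin 4)) :=
      contMDiff_iff_contDiff.2 Le.contDiff
    refine (h1.comp h2.contMDiffOn fun z hz => ?_).congr fun z _ => hΘ₀symm z
    -- `z ∈ Θ₀.target` gives `Le z ∈ ψ.target`
    rw [hΘ₀, OpenPartialHomeomorph.trans_target] at hz
    simpa using hz.2
  refine ⟨⟨Θ, hΘ₀s.mono (by rw [hΘsrc]; exact inter_subset_left),
    hΘ₀s'.mono (by intro z hz; exact hz.1),
    fun q hq => ?_⟩, ?_, ?_⟩
  · -- `q ∈ range e ↔ 0 ≤ Θ q 0`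
    rw [hΘsrc] at hq
    obtain ⟨hqψ, ⟨hqV', hqN⟩, -⟩ := hq
    rw [hΘ₀src] at hqψ
    constructor
    · rintro ⟨w', rfl⟩
      have hw'φ : w' ∈ φ.source := by rw [← hNe]; exact hqN
      obtain ⟨h1, h2⟩ := hΘe w' hw'φ
      rw [hΘcoe, h1]
      rw [htgt] at h2
      exact h2.2
    · intro hq0
      have hzt : Le.symm (ψ q) ∈ (φ.extend (𝓡∂ 4)).target := by
        rw [htgt]; exact ⟨hqV', hq0⟩
      have h1 := hkey _ hzt
      rw [← hLe, ContinuousLinearEquiv.apply_symm_apply] at h1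
      set w' := φ.symm ((𝓡∂ 4).symm (Le.symm (ψ q))) with hw'
      have hw'φ : w' ∈ φ.source := by
        have := (φ.extend (𝓡∂ 4)).map_target hzt
        rw [OpenPartialHomeomorph.extend_source, hext_symm] at this
        exact this
      have hew' : e w' ∈ ψ.source := hsrc hw'φ
      have : e w' = q := ψ.injOn hew' hqψ h1
      exact ⟨w', this⟩
  · -- `e w ∈ Θ.source`
    rw [hΘsrc, hΘ₀src]
    obtain ⟨h1, h2⟩ := hΘe w hwφ
    refine ⟨hsrc hwφ, ⟨?_, by rw [← hNe] at hwφ; exact hwφ⟩, hwV⟩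
    show Le.symm (ψ (e w)) ∈ V'
    rw [h1]; rw [htgt] at h2; exact h2.1
  · rw [hΘsrc]; exact fun q hq => hq.2.2

end HalfSlice

/-! ### The corner-slice atlas of a sector -/

section Atlas

variable {X : Type u} [TopologicalSpace X] [T2Space X] [CompactSpace X]
  [ChartedSpace (EuclideanSpace ℝ (Fin 4)) X] [IsManifold (𝓡 4) ∞ X]
  {g : ℕ} {k : Fin 3 → ℕ} {S : Fin 3 → Set X}

/-- **The corner-slice atlas of a sector of a Gay–Kirby trisection** (re-structuring the sector
from ambient data).  For a trisection with corners `S` of a closed smooth `4`-manifold `X`, a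
sector `S i` and a second sector `S j`, there are global normal coordinates `u, v`, a smooth
retraction `ρ` of a neighbourhood `O` of the central surface `F` onto `F`
(`IsGKTrisection.exists_cornerSliceCharts`) and a **corner-slice atlas**
`Literature.Topology.FourManifolds.CornerSliceAtlas (S i) F u v ρ`: corner-slice charts at the
points of `F`, and half-slice charts avoiding `F` at the other points of `S i` (at such a point
`S i` is the image of the sector manifold of clause (ii) near an immersion point,
`exists_halfSliceChart_of_isImmersionAt`).  With the straightened structure
`CornerSliceAtlas.chartedSpace` the subset `S i` becomes a smooth `4`-manifold with boundary
whose inclusion is an immersion off `F` and has corner charts along `F`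
(`CornerSliceAtlas.sector_smooth_clause`). [cite: GayKirby2016, Def. 1; Douady1961, §4] -/
theorem IsGKTrisection.exists_cornerSliceAtlas (h : IsGKTrisection X g k S) {i j : Fin 3}
    (hji : j ≠ i) :
    ∃ (u v : X → ℝ) (U O : Set X) (ρ : X → X) (l : Fin 3), l ≠ i ∧ l ≠ j ∧ IsOpen U ∧
      IsOpen O ∧ (⋂ m, S m) ⊆ O ∧ O ⊆ U ∧
      ContMDiff (𝓡 4) 𝓘(ℝ, ℝ) ∞ u ∧ ContMDiff (𝓡 4) 𝓘(ℝ, ℝ) ∞ v ∧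
      ContMDiff (𝓡 4) (𝓡 4) ∞ ρ ∧
      (∀ y ∈ U, y ∈ S i ↔ 0 ≤ u y ∧ 0 ≤ v y) ∧
      (∀ y ∈ U, y ∈ S j ↔ u y ≤ 0 ∧ u y ≤ v y) ∧
      (∀ y ∈ U, y ∈ S l ↔ v y ≤ 0 ∧ v y ≤ u y) ∧
      (∀ y ∈ U, y ∈ (⋂ m, S m) ↔ u y = 0 ∧ v y = 0) ∧
      (∀ y ∈ O, ρ y ∈ ⋂ m, S m) ∧ (∀ y ∈ U, u y = 0 → v y = 0 → ρ y = y) ∧ MapsTo ρ O O ∧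
      ∃ Φ : CornerSliceAtlas (S i) (⋂ m, S m) u v ρ,
        ∀ (p : ↥(S i)) (hp : p.1 ∈ ⋂ m, S m), (Φ.cornerDatum p hp).Θ.source ⊆ O := by
  obtain ⟨u, v, U, O, ρ, l, hli, hlj, hUo, hOo, hFO, hOU, hu, hv, hρ, hSi, hSj, hSl, hF, hρF,
    hρfix, hρO, hc⟩ := h.exists_cornerSliceCharts hji
  -- the sector manifold of clause (ii) and its immersion points
  obtain ⟨W, _, _, e, hM, -, -, -, he, hrange, himm, -, -⟩ := h.2.1 i
  haveI := hM
  have hFc : IsClosed (⋂ m, S m) := h.isCompact_iInter.isClosed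
  have hhalf : ∀ p : ↥(S i), p.1 ∉ (⋂ m, S m) → ∃ D : HalfSliceChart (𝓡 4) (S i),
      p.1 ∈ D.Θ.source ∧ ∀ q ∈ D.Θ.source, q ∉ ⋂ m, S m := by
    intro p hp
    have hpS : p.1 ∈ range e := by rw [hrange]; exact p.2
    obtain ⟨w, hw⟩ := hpS
    have himmw : Manifold.IsImmersionAt (𝓡∂ 4) (𝓡 4) ∞ e w := himm w (by rw [hw]; exact hp)
    obtain ⟨D, hD, hDV⟩ := exists_halfSliceChart_of_isImmersionAt he hrange himmw
      hFc.isOpen_compl (by rw [hw]; exact hp)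
    exact ⟨D, by rw [← hw]; exact hD, fun q hq hqF => hDV hq hqF⟩
  choose Dh hDh₁ hDh₂ using hhalf
  have hcorner : ∀ p : ↥(S i), p.1 ∈ (⋂ m, S m) →
      ∃ c : CornerSliceChart (S i) (⋂ m, S m) u v ρ, p.1 ∈ c.Θ.source ∧ c.Θ.source ⊆ O :=
    fun p hp => hc p.1 hp
  choose Dc hDc₁ hDc₂ using hcorner
  exact ⟨u, v, U, O, ρ, l, hli, hlj, hUo, hOo, hFO, hOU, hu, hv, hρ, hSi, hSj, hSl, hF, hρF,
    hρfix, hρO, ⟨Dh, hDh₁, hDh₂, Dc, hDc₁⟩, fun p hp => hDc₂ p hp⟩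

end Atlas

end Literature.Topology.FourManifolds
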